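import Literature.NumberTheory.EllipticCurves.CompactSelmerTowerNormProofs
import Literature.NumberTheory.EllipticCurves.PAdicLFunctionProofs
import HarnessLib

/-!
# The Heegner-module envelope, DESCENT of the stabilised differences `D_j = δ(u_j) − α⁻¹·δ(v_j)` along the
# anticyclotomic tower from three point identities of a coherent pair `(C, F)` (CGLS 2022 Rem. 4.1.4 /
# Howard 2004 §3.3 / Perrin-Riou 1987 §3.3; proofs file)

Topic `NumberTheory/EllipticCurves`. THEOREMS ONLY (no definition, no named fact, no `sorry`); sequel of
`CompactSelmerTowerNormProofs`. Written by the cell `bsd-print-x9` seat `bsd-line-x9-p2` for the stub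
`stub_envelopeTied` of crux stmt-BirchSwinnertonDyer-26359 `PrintX9.HowardContainmentLightFramePinnedOfPrint`.

SETTING. `C` is a `d(k)`-shifted stabilised Heegner datum (`u_k`, `v_k`, torsion depth `δ`), `γ` a topological
generator, `α = unitRoot W p` (good ordinary `p`: `α² − a_p α + p = 0`, `α ∈ ℤ_pˣ`), `a_p = W.frobeniusTrace p`.
The COHERENCE of `C` (print's datum built on ONE CM system; cf. the module docstring of
`CastellaGrossiLeeSkinner2022/HowardDivisibilityAnyClassNumber.lean`) is expressed by two POINT IDENTITIES in
`E(K̄)` above the depth (`j > δ`):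
* (P1) `v_{j+1} = u_j` — the lower norm point at layer `j+1` is the norm point of layer `j`;
* (P2) `Σ_{i<p} γ^{p^j i} • u_{j+1} = a_p • u_j − v_j` — the vertical distribution relation
  `N_{K_{j+1}/K_j} u_{j+1} = a_p u_j − v_j` (`Gal(K_{j+1}/K_j) = {γ^{p^j i}}_{i<p}`).
For the Kummer families `du_j, dv_j` over a layer `K_ℓ` (`ℓ ≥ j`) write `D_j = du_j − α⁻¹ · dv_j`
(`α⁻¹ = Ring.inverse α` through `padicPi`); CGLS's class is `κ_ℓ = α^{-d(ℓ)} · D_ℓ` (`stabilizedClassLayer`).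

WHAT.
* §1 `frobeniusTrace_sub_ringInverse_unitRoot_mul` — `a_p − α⁻¹ p = α` in `ℤ_p`; small closure lemmas for
  `ℤ_p[G_k]·κ_k` (`stabilizedModuleLayer`): `conjPi_one`, membership of the class representatives, sums of
  `conj`-translates.
* §2 `sum_conjPi_kummerDiff_eq_unitRoot_smul` — the ONE-STEP DESCENT over `K_ℓ`:
  `Σ_{i<p} conj_{γ^{p^j i}} D_{j+1} = α · D_j` (Kummer images of (P1), (P2); `a_p − α⁻¹p = α`).
* §3 `kummerDiff_mem_stabilizedModuleLayer` — for `δ < j ≤ k`: `D_j ∈ ℤ_p[G_k]·κ_k` over `K_k` (downward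
  induction from `D_k = α^{d(k)} κ_k`; the norm sums and `α⁻¹` preserve the module).
* §4 `sum_conjPi_kummerDiff_eq_unitRoot_pow_smul` — the ITERATED DESCENT over `K_ℓ`:
  `Σ_{i<pⁿ} conj_{γ^{p^k i}} D_{k+n} = αⁿ · D_k` (`k > δ`, `k + n ≤ ℓ`).
HONEST FRAMING: Kummer-theoretic bookkeeping of printed distribution relations; nothing about any particular
curve; BSD is not proved by any of this.

References: [CastellaGrossiLeeSkinner2022] Thm. 4.1.1 proof and Rem. 4.1.4 (`P[p^d]_α = P[p^d] − α⁻¹P[p^{d−1}]`,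
`Norm P[p^{d+1}]_α = α P[p^d]_α`, `κ_k`, arXiv:2008.02571v2 TeX L2213–2294); [Howard2004HeegnerKolyvagin] §3.3
(`H_k`, norm relations); [PerrinRiou1987BSMF] §3.3 Lemme 1–Prop. 3 (relations de distribution, `α`-stabilisation);
[MazurTateTeitelbaum1986Invent] §I.11 (unit root).
-/

set_option autoImplicit false

noncomputable section

open scoped Classical

open WeierstrassCurve Literature.NumberTheory.EllipticCurves
  Literature.NumberTheory.EllipticCurves.CastellaGrossiLeeSkinner2022 PowerSeries

universe u

namespace Literature.NumberTheory.EllipticCurves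

/-! ## §1 The unit-root identity and small closure lemmas -/

section UnitRoot

variable (W : WeierstrassCurve ℚ) [W.IsGloballyMinimal] (p : ℕ) [Fact p.Prime]

/-- **`a_p − α⁻¹·p = α` in `ℤ_p`** at a good ordinary prime (`α² − a_p α + p = 0`, `α` a unit: multiply by
`α⁻¹`). This is the identity behind `Norm(P[p^{d+1}] − α⁻¹P[p^d]) = a_pP[p^d] − P[p^{d-1}] − α⁻¹pP[p^d] =
α(P[p^d] − α⁻¹P[p^{d−1}])`. [cite: MazurTateTeitelbaum1986Invent, §I.11 (allowable root)]
[cite: CastellaGrossiLeeSkinner2022, Rem. 4.1.4 (eq. stabilized-1)] -/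
theorem frobeniusTrace_sub_ringInverse_unitRoot_mul (hord : IsOrdinaryAt W p) :
    ((W.frobeniusTrace p : ℤ) : ℤ_[p]) - Ring.inverse (unitRoot W p) * (p : ℤ_[p]) = unitRoot W p := by
  obtain ⟨hspec, hunit⟩ := unitRoot_spec_holds W p hord
  have h1 : Ring.inverse (unitRoot W p) * unitRoot W p = 1 := Ring.inverse_mul_cancel _ hunit
  linear_combination (-Ring.inverse (unitRoot W p)) * hspec + (unitRoot W p - (W.frobeniusTrace p : ℤ_[p])) * h1

/-- `α^n · (α⁻¹)^n = 1` for the unit root. [cite: MazurTateTeitelbaum1986Invent, §I.11 (allowable root)] -/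
theorem unitRoot_pow_mul_ringInverse_pow (hord : IsOrdinaryAt W p) (n : ℕ) :
    unitRoot W p ^ n * Ring.inverse (unitRoot W p) ^ n = 1 := by
  rw [← mul_pow, Ring.mul_inverse_cancel _ (unitRoot_spec_holds W p hord).2, one_pow]

end UnitRoot

section Closure

variable {K : Type u} [Field K] (V : WeierstrassCurve K) (p : ℕ) [Fact p.Prime]
  (H : Subgroup (Field.absoluteGaloisGroup K))

omit [Fact p.Prime] in
/-- `conj_1 = id` on `∏_m H¹(H, E[p^m])` (`conjH1_one_holds` componentwise).
[cite: NeukirchSchmidtWingberg2008, I.§5 (conjugation action on H¹)] -/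
theorem _root_.WeierstrassCurve.conjPi_one [H.Normal] (y : V.torsionH1Pi p H) : V.conjPi p H 1 y = y := by
  funext k
  simp only [conjPi, AddMonoidHom.pi_apply, AddMonoidHom.coe_comp, Function.comp_apply,
    Pi.evalAddMonoidHom_apply]
  rw [Literature.NumberTheory.EllipticCurves.conjH1_one_holds, AddMonoidHom.id_apply]

/-- `(Σ_b c_b) · y = Σ_b c_b · y` for the `ℤ_p`-action. [cite: PerrinRiou1987BSMF, §0 p. 401 (the ℤ_p-module structure of S_p(L))] -/
theorem _root_.WeierstrassCurve.padicPi_finset_sum_left {ι : Type*} (s : Finset ι) (c : ι → ℤ_[p])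
    (y : V.torsionH1Pi p H) : V.padicPi p H (∑ b ∈ s, c b) y = ∑ b ∈ s, V.padicPi p H (c b) y := by
  induction s using Finset.induction_on with
  | empty => rw [Finset.sum_empty, Finset.sum_empty, padicPi_zero_left]
  | insert b s hb ih => rw [Finset.sum_insert hb, Finset.sum_insert hb, padicPi_add_left, ih]

end Closure

section StabilizedLayer

variable {N : ℕ} [NeZero N] {W : WeierstrassCurve ℚ} [W.IsGloballyMinimal] {K : Type u} [Field K]
  [NumberField K] {p : ℕ} [Fact p.Prime] {κ : ZpExtension K p} (γ : Field.absoluteGaloisGroup K)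
  {jbar : AlgebraicClosure K →+* ℂ} (C : StabilizedHeegnerData N W K κ jbar) (k : ℕ) (hk : C.depth < k)

/-- The representatives of `δ(κ_k)` lie in `ℤ_p[Gal(K_k/K)]·κ_k` (`c = 1`, `i = 0`).
[cite: CastellaGrossiLeeSkinner2022, Rem. 4.1.4 (κ_k)] -/
theorem mem_stabilizedModuleLayer_of_mem_stabilizedClassLayer
    {x : (W.baseChange K).torsionH1Pi p (κ.layerSubgroup k)} (hx : x ∈ stabilizedClassLayer C k hk) :
    x ∈ stabilizedModuleLayer γ C k hk := by
  refine AddSubgroup.subset_closure ⟨1, 0, x, hx, ?_⟩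
  rw [pow_zero, conjPi_one, padicPi_one]

/-- `ℤ_p[Gal(K_k/K)]·κ_k` is stable under the norm-type sums `Σ_{i ∈ s} conj_{γ^{e i}}`.
[cite: CastellaGrossiLeeSkinner2022, Rem. 4.1.4 (the module Λκ_∞)] -/
theorem sum_conjPi_pow_mem_stabilizedModuleLayer (s : Finset ℕ) (e : ℕ → ℕ)
    {y : (W.baseChange K).torsionH1Pi p (κ.layerSubgroup k)} (hy : y ∈ stabilizedModuleLayer γ C k hk) :
    ∑ i ∈ s, (W.baseChange K).conjPi p (κ.layerSubgroup k) (γ ^ e i) y ∈ stabilizedModuleLayer γ C k hk :=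
  AddSubgroup.sum_mem _ fun i _ ↦ conjPi_pow_mem_stabilizedModuleLayer γ C k hk (e i) hy

/-- If `a · y ∈ ℤ_p[Gal(K_k/K)]·κ_k` for a unit `a` of `ℤ_p`, then `y ∈ ℤ_p[Gal(K_k/K)]·κ_k`.
[cite: CastellaGrossiLeeSkinner2022, Rem. 4.1.4 (the module Λκ_∞)] -/
theorem mem_stabilizedModuleLayer_of_padicPi_mem {a : ℤ_[p]} (ha : IsUnit a)
    {y : (W.baseChange K).torsionH1Pi p (κ.layerSubgroup k)}
    (hy : (W.baseChange K).padicPi p (κ.layerSubgroup k) a y ∈ stabilizedModuleLayer γ C k hk) :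
    y ∈ stabilizedModuleLayer γ C k hk := by
  rw [← padicPi_ringInverse_mul (W.baseChange K) p (κ.layerSubgroup k) ha y]
  exact padicPi_mem_stabilizedModuleLayer γ C k hk _ hy

end StabilizedLayer

/-! ## §2 The one-step descent of the stabilised differences -/

section Descent

variable {N : ℕ} [NeZero N] {W : WeierstrassCurve ℚ} [W.IsGloballyMinimal] [W.IsElliptic] {K : Type u}
  [Field K] [NumberField K] {p : ℕ} [Fact p.Prime] {κ : ZpExtension K p} {γ : Field.absoluteGaloisGroup K}
  {jbar : AlgebraicClosure K →+* ℂ} (C : StabilizedHeegnerData N W K κ jbar)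

omit [W.IsGloballyMinimal] in
/-- **Norm of the Kummer family of `v_{j+1} = u_j`**: over any layer `K_ℓ`,
`Σ_{i<p} conj_{γ^{p^j i}} δ(v_{j+1}) = p • δ(u_j)` (by (P1) `δ(v_{j+1}) = δ(u_j)`, and `u_j ∈ E(K_j)`).
[cite: CastellaGrossiLeeSkinner2022, Thm. 4.1.1 proof (P_k[n] = Norm_{K[np^{d(k)}]/K_k[n]} P[np^{d(k)}], d(k))] -/
theorem sum_conjPi_kummer_v_succ_eq (hγ : κ.IsTopGenerator γ) {j ℓ : ℕ} (hj : C.depth < j)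
    (hvu : C.v (j + 1) = C.u j) (hjℓ : κ.layerSubgroup ℓ ≤ κ.layerSubgroup j)
    {hv' : ∀ σ ∈ κ.layerSubgroup ℓ, σ • C.v (j + 1) = C.v (j + 1)}
    {hu : ∀ σ ∈ κ.layerSubgroup ℓ, σ • C.u j = C.u j}
    {dv' du : (W.baseChange K).torsionH1Pi p (κ.layerSubgroup ℓ)}
    (hdv' : (W.baseChange K).IsKummerFamilyOver p (κ.layerSubgroup ℓ) hv' dv')
    (hdu : (W.baseChange K).IsKummerFamilyOver p (κ.layerSubgroup ℓ) hu du) :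
    ∑ i ∈ Finset.range p, (W.baseChange K).conjPi p (κ.layerSubgroup ℓ) (γ ^ (p ^ j * i)) dv' =
      (p : ℤ) • du := by
  have hfix : ∀ σ ∈ κ.layerSubgroup j, σ • C.u j = C.u j := fun σ hσ ↦ C.smul_u_eq hj hσ
  have hdv'u : (W.baseChange K).IsKummerFamilyOver p (κ.layerSubgroup ℓ) (fun σ hσ ↦ hfix σ (hjℓ hσ)) dv' :=
    IsKummerFamilyOver.of_eq hvu hdv'
  have heq : dv' = du := IsKummerFamilyOver.unique p hdv'u hdu
  have h := (W.baseChange K).sum_conjPi_eq_pow_smul_of_isKummerFamilyOver p κ hγ (n := 1) hjℓ hfix hdv'u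
  rw [pow_one, pow_one] at h
  rw [h, heq]

/-- **Norm of the Kummer family of `u_{j+1}`**: over any layer `K_ℓ`,
`Σ_{i<p} conj_{γ^{p^j i}} δ(u_{j+1}) = a_p · δ(u_j) − δ(v_j)` (Kummer image of (P2)).
[cite: Howard2004HeegnerKolyvagin, §3.3 (norm relations of the P_k[n])] [cite: PerrinRiou1987BSMF, §3.3 Lemme 1] -/
theorem sum_conjPi_kummer_u_succ_eq {j ℓ : ℕ}
    (hnorm : ∑ i ∈ Finset.range p, (γ ^ (p ^ j * i)) • C.u (j + 1) = (W.frobeniusTrace p) • C.u j - C.v j)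
    {hu' : ∀ σ ∈ κ.layerSubgroup ℓ, σ • C.u (j + 1) = C.u (j + 1)}
    {hu : ∀ σ ∈ κ.layerSubgroup ℓ, σ • C.u j = C.u j} {hv : ∀ σ ∈ κ.layerSubgroup ℓ, σ • C.v j = C.v j}
    {du' du dv : (W.baseChange K).torsionH1Pi p (κ.layerSubgroup ℓ)}
    (hdu' : (W.baseChange K).IsKummerFamilyOver p (κ.layerSubgroup ℓ) hu' du')
    (hdu : (W.baseChange K).IsKummerFamilyOver p (κ.layerSubgroup ℓ) hu du)
    (hdv : (W.baseChange K).IsKummerFamilyOver p (κ.layerSubgroup ℓ) hv dv) :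
    ∑ i ∈ Finset.range p, (W.baseChange K).conjPi p (κ.layerSubgroup ℓ) (γ ^ (p ^ j * i)) du' =
      (W.frobeniusTrace p) • du - dv := by
  -- the Kummer family of the norm sum `Σ γ^{p^j i} • u_{j+1}`
  have hsum := IsKummerFamilyOver.sum (p := p) (Finset.range p)
    (fun i ↦ IsKummerFamilyOver.conjPi (γ ^ (p ^ j * i)) hdu')
  -- the Kummer family of `a_p • u_j − v_j`
  have hrhs : (W.baseChange K).IsKummerFamilyOver p (κ.layerSubgroup ℓ)
      (P := (W.frobeniusTrace p) • C.u j + -C.v j)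
      (fun σ hσ ↦ by rw [smul_add, smul_neg, smul_zsmul_geomPoints, hu σ hσ, hv σ hσ])
      ((W.frobeniusTrace p) • du + -dv) :=
    IsKummerFamilyOver.add p (IsKummerFamilyOver.zsmul hdu (W.frobeniusTrace p)) (IsKummerFamilyOver.neg hdv)
  have heq : ∑ i ∈ Finset.range p, (γ ^ (p ^ j * i)) • C.u (j + 1) = (W.frobeniusTrace p) • C.u j + -C.v j := by
    rw [hnorm, sub_eq_add_neg]
  have h := IsKummerFamilyOver.unique p (IsKummerFamilyOver.of_eq heq hsum) hrhs
  rw [h, sub_eq_add_neg]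

/-- **ONE-STEP DESCENT**: over any layer `K_ℓ` containing `K_{j+1}` (`j > δ`), with `D_i = δ(u_i) − α⁻¹·δ(v_i)`:
`Σ_{i<p} conj_{γ^{p^j i}} D_{j+1} = α · D_j` — from (P1), (P2) and `a_p − α⁻¹ p = α`. This is the Kummer image
of CGLS's `Norm P[p^{d+1}]_α = α · P[p^d]_α` along the layer step `K_{j+1}/K_j`.
[cite: CastellaGrossiLeeSkinner2022, Rem. 4.1.4 (eq. stabilized-1, κ_k norm-compatible)] [cite: PerrinRiou1987BSMF, §3.3 Prop. 3] -/
theorem sum_conjPi_kummerDiff_eq_unitRoot_smul (hord : IsOrdinaryAt W p) (hγ : κ.IsTopGenerator γ)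
    {j ℓ : ℕ} (hj : C.depth < j) (hjℓ : κ.layerSubgroup ℓ ≤ κ.layerSubgroup j)
    (hvu : C.v (j + 1) = C.u j)
    (hnorm : ∑ i ∈ Finset.range p, (γ ^ (p ^ j * i)) • C.u (j + 1) = (W.frobeniusTrace p) • C.u j - C.v j)
    {hu' : ∀ σ ∈ κ.layerSubgroup ℓ, σ • C.u (j + 1) = C.u (j + 1)}
    {hv' : ∀ σ ∈ κ.layerSubgroup ℓ, σ • C.v (j + 1) = C.v (j + 1)}
    {hu : ∀ σ ∈ κ.layerSubgroup ℓ, σ • C.u j = C.u j} {hv : ∀ σ ∈ κ.layerSubgroup ℓ, σ • C.v j = C.v j}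
    {du' dv' du dv : (W.baseChange K).torsionH1Pi p (κ.layerSubgroup ℓ)}
    (hdu' : (W.baseChange K).IsKummerFamilyOver p (κ.layerSubgroup ℓ) hu' du')
    (hdv' : (W.baseChange K).IsKummerFamilyOver p (κ.layerSubgroup ℓ) hv' dv')
    (hdu : (W.baseChange K).IsKummerFamilyOver p (κ.layerSubgroup ℓ) hu du)
    (hdv : (W.baseChange K).IsKummerFamilyOver p (κ.layerSubgroup ℓ) hv dv) :
    ∑ i ∈ Finset.range p, (W.baseChange K).conjPi p (κ.layerSubgroup ℓ) (γ ^ (p ^ j * i))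
        (du' - (W.baseChange K).padicPi p (κ.layerSubgroup ℓ) (Ring.inverse (unitRoot W p)) dv') =
      (W.baseChange K).padicPi p (κ.layerSubgroup ℓ) (unitRoot W p)
        (du - (W.baseChange K).padicPi p (κ.layerSubgroup ℓ) (Ring.inverse (unitRoot W p)) dv) := by
  have hunit : IsUnit (unitRoot W p) := (unitRoot_spec_holds W p hord).2
  rw [sum_conjPi_sub, sum_conjPi_padicPi, sum_conjPi_kummer_u_succ_eq C hnorm hdu' hdu hdv,
    sum_conjPi_kummer_v_succ_eq C hγ hj hvu hjℓ hdv' hdu, map_sub, padicPi_padicPi,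
    Ring.mul_inverse_cancel _ hunit, padicPi_one, ← padicPi_intCast, ← padicPi_intCast, padicPi_padicPi,
    sub_right_comm, ← padicPi_sub_left, Int.cast_natCast, frobeniusTrace_sub_ringInverse_unitRoot_mul W p hord]

end Descent

/-! ## §3 `D_j ∈ ℤ_p[Gal(K_k/K)]·κ_k` for `δ < j ≤ k` -/

section Membership

variable {N : ℕ} [NeZero N] {W : WeierstrassCurve ℚ} [W.IsGloballyMinimal] [W.IsElliptic] {K : Type u}
  [Field K] [NumberField K] {p : ℕ} [Fact p.Prime] {κ : ZpExtension K p} (γ : Field.absoluteGaloisGroup K)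
  {jbar : AlgebraicClosure K →+* ℂ} (C : StabilizedHeegnerData N W K κ jbar)

/-- **`D_j ∈ ℤ_p[Gal(K_k/K)]·κ_k` for `δ < j ≤ k`** (Kummer families over `K_k`): at `j = k`,
`D_k = α^{d(k)} · κ_k`; the step `j+1 ↦ j` is the one-step descent (`α · D_j` is a sum of
`conj_{γ^{p^j i}}`-translates of `D_{j+1}`) and `α` is a unit.
[cite: CastellaGrossiLeeSkinner2022, Rem. 4.1.4 (κ_∞ = lim← κ_k; κ_k norm-compatible)] -/
theorem kummerDiff_mem_stabilizedModuleLayer (hord : IsOrdinaryAt W p) (hγ : κ.IsTopGenerator γ)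
    (hvu : ∀ j, C.depth < j → C.v (j + 1) = C.u j)
    (hnorm : ∀ j, C.depth < j →
      ∑ i ∈ Finset.range p, (γ ^ (p ^ j * i)) • C.u (j + 1) = (W.frobeniusTrace p) • C.u j - C.v j)
    {k : ℕ} (hk : C.depth < k) :
    ∀ (n j : ℕ), C.depth < j → j + n = k →
      ∀ {hu : ∀ σ ∈ κ.layerSubgroup k, σ • C.u j = C.u j} {hv : ∀ σ ∈ κ.layerSubgroup k, σ • C.v j = C.v j}
        {du dv : (W.baseChange K).torsionH1Pi p (κ.layerSubgroup k)},
        (W.baseChange K).IsKummerFamilyOver p (κ.layerSubgroup k) hu du →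
        (W.baseChange K).IsKummerFamilyOver p (κ.layerSubgroup k) hv dv →
        du - (W.baseChange K).padicPi p (κ.layerSubgroup k) (Ring.inverse (unitRoot W p)) dv ∈
          stabilizedModuleLayer γ C k hk := by
  have hunit : IsUnit (unitRoot W p) := (unitRoot_spec_holds W p hord).2
  intro n
  induction n with
  | zero =>
    intro j hj hjk hu hv du dv hdu hdv
    obtain rfl : j = k := by simpa using hjk
    -- `D_k = α^{d k} · κ_k` with `κ_k ∈ stabilizedClassLayer`
    have hx : (W.baseChange K).padicPi p (κ.layerSubgroup j) (Ring.inverse (unitRoot W p) ^ C.d j)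
        (du - (W.baseChange K).padicPi p (κ.layerSubgroup j) (Ring.inverse (unitRoot W p)) dv) ∈
          stabilizedClassLayer C j hk :=
      ⟨du, dv, hdu, hdv, rfl⟩
    have hm := padicPi_mem_stabilizedModuleLayer γ C j hk (unitRoot W p ^ C.d j)
      (mem_stabilizedModuleLayer_of_mem_stabilizedClassLayer γ C j hk hx)
    rwa [padicPi_padicPi, unitRoot_pow_mul_ringInverse_pow W p hord, padicPi_one] at hm
  | succ n ih =>
    intro j hj hjk hu hv du dv hdu hdv
    have hj' : C.depth < j + 1 := Nat.lt_succ_of_lt hj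
    have hjk' : j + 1 + n = k := by omega
    have hjk_le : j + 1 ≤ k := by omega
    have hkj : κ.layerSubgroup k ≤ κ.layerSubgroup j := κ.layerSubgroup_antitone (by omega)
    -- Kummer families of `u_{j+1}, v_{j+1}` over `K_k`
    have hu' : ∀ σ ∈ κ.layerSubgroup k, σ • C.u (j + 1) = C.u (j + 1) :=
      fun σ hσ ↦ C.smul_u_eq hj' (κ.layerSubgroup_antitone hjk_le hσ)
    have hv' : ∀ σ ∈ κ.layerSubgroup k, σ • C.v (j + 1) = C.v (j + 1) :=
      fun σ hσ ↦ C.smul_v_eq hj' (κ.layerSubgroup_antitone hjk_le hσ)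
    obtain ⟨du', hdu'⟩ := exists_isKummerFamilyOver (W.baseChange K) p (κ.layerSubgroup k) _ hu'
    obtain ⟨dv', hdv'⟩ := exists_isKummerFamilyOver (W.baseChange K) p (κ.layerSubgroup k) _ hv'
    have hD' := ih (j + 1) hj' hjk' hdu' hdv'
    have hstep := sum_conjPi_kummerDiff_eq_unitRoot_smul C hord hγ hj hkj (hvu j hj) (hnorm j hj)
      hdu' hdv' hdu hdv
    have hmem := sum_conjPi_pow_mem_stabilizedModuleLayer γ C k hk (Finset.range p) (fun i ↦ p ^ j * i) hD'
    rw [hstep] at hmem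
    exact mem_stabilizedModuleLayer_of_padicPi_mem γ C k hk hunit hmem

/-- **`D_j ∈ ℤ_p[Gal(K_k/K)]·κ_k`**, packaged: for `δ < j ≤ k` and Kummer families `du, dv` of `u_j, v_j`
over `K_k`, `du − α⁻¹·dv ∈ stabilizedModuleLayer γ C k`. [cite: CastellaGrossiLeeSkinner2022, Rem. 4.1.4] -/
theorem kummerDiff_mem_stabilizedModuleLayer_of_le (hord : IsOrdinaryAt W p) (hγ : κ.IsTopGenerator γ)
    (hvu : ∀ j, C.depth < j → C.v (j + 1) = C.u j)
    (hnorm : ∀ j, C.depth < j →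
      ∑ i ∈ Finset.range p, (γ ^ (p ^ j * i)) • C.u (j + 1) = (W.frobeniusTrace p) • C.u j - C.v j)
    {k j : ℕ} (hk : C.depth < k) (hj : C.depth < j) (hjk : j ≤ k)
    {hu : ∀ σ ∈ κ.layerSubgroup k, σ • C.u j = C.u j} {hv : ∀ σ ∈ κ.layerSubgroup k, σ • C.v j = C.v j}
    {du dv : (W.baseChange K).torsionH1Pi p (κ.layerSubgroup k)}
    (hdu : (W.baseChange K).IsKummerFamilyOver p (κ.layerSubgroup k) hu du)
    (hdv : (W.baseChange K).IsKummerFamilyOver p (κ.layerSubgroup k) hv dv) :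
    du - (W.baseChange K).padicPi p (κ.layerSubgroup k) (Ring.inverse (unitRoot W p)) dv ∈
      stabilizedModuleLayer γ C k hk :=
  kummerDiff_mem_stabilizedModuleLayer γ C hord hγ hvu hnorm hk (k - j) j hj (by omega) hdu hdv

end Membership

/-! ## §4 The iterated descent -/

section Iterated

variable {N : ℕ} [NeZero N] {W : WeierstrassCurve ℚ} [W.IsGloballyMinimal] [W.IsElliptic] {K : Type u}
  [Field K] [NumberField K] {p : ℕ} [Fact p.Prime] {κ : ZpExtension K p} {γ : Field.absoluteGaloisGroup K}
  {jbar : AlgebraicClosure K →+* ℂ} (C : StabilizedHeegnerData N W K κ jbar)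

/-- **ITERATED DESCENT**: over a layer `K_ℓ` with `k + n ≤ ℓ` and `k > δ`, for Kummer families of
`u_{k+n}, v_{k+n}` and of `u_k, v_k` over `K_ℓ`:
`Σ_{i<pⁿ} conj_{γ^{p^k i}} D_{k+n} = αⁿ · D_k` — the norm compatibility `N_{K_{k+n}/K_k} κ_{k+n} = κ_k` of
CGLS's classes up to the unit `α^{d(k+n)−d(k)−n}`, from (P1), (P2) by induction on `n` (product
decomposition of the norm sums, one-step descent).
[cite: CastellaGrossiLeeSkinner2022, Rem. 4.1.4 (κ_∞ := lim← κ_k)] [cite: PerrinRiou1987BSMF, §3.3 Prop. 3, Cor. 5] -/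
theorem sum_conjPi_kummerDiff_eq_unitRoot_pow_smul (hord : IsOrdinaryAt W p) (hγ : κ.IsTopGenerator γ)
    (hvu : ∀ j, C.depth < j → C.v (j + 1) = C.u j)
    (hnorm : ∀ j, C.depth < j →
      ∑ i ∈ Finset.range p, (γ ^ (p ^ j * i)) • C.u (j + 1) = (W.frobeniusTrace p) • C.u j - C.v j)
    {ℓ : ℕ} :
    ∀ (n k : ℕ), C.depth < k → k + n ≤ ℓ →
      ∀ {hun : ∀ σ ∈ κ.layerSubgroup ℓ, σ • C.u (k + n) = C.u (k + n)}
        {hvn : ∀ σ ∈ κ.layerSubgroup ℓ, σ • C.v (k + n) = C.v (k + n)}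
        {hu : ∀ σ ∈ κ.layerSubgroup ℓ, σ • C.u k = C.u k} {hv : ∀ σ ∈ κ.layerSubgroup ℓ, σ • C.v k = C.v k}
        {dun dvn du dv : (W.baseChange K).torsionH1Pi p (κ.layerSubgroup ℓ)},
        (W.baseChange K).IsKummerFamilyOver p (κ.layerSubgroup ℓ) hun dun →
        (W.baseChange K).IsKummerFamilyOver p (κ.layerSubgroup ℓ) hvn dvn →
        (W.baseChange K).IsKummerFamilyOver p (κ.layerSubgroup ℓ) hu du →
        (W.baseChange K).IsKummerFamilyOver p (κ.layerSubgroup ℓ) hv dv →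
        ∑ i ∈ Finset.range (p ^ n), (W.baseChange K).conjPi p (κ.layerSubgroup ℓ) (γ ^ (p ^ k * i))
            (dun - (W.baseChange K).padicPi p (κ.layerSubgroup ℓ) (Ring.inverse (unitRoot W p)) dvn) =
          (W.baseChange K).padicPi p (κ.layerSubgroup ℓ) (unitRoot W p ^ n)
            (du - (W.baseChange K).padicPi p (κ.layerSubgroup ℓ) (Ring.inverse (unitRoot W p)) dv) := by
  intro n
  induction n with
  | zero =>
    intro k hk hkℓ hun hvn hu hv dun dvn du dv hdun hdvn hdu hdv
    have h1 : dun = du := IsKummerFamilyOver.unique p hdun hdu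
    have h2 : dvn = dv := IsKummerFamilyOver.unique p hdvn hdv
    rw [pow_zero, Finset.sum_range_one, mul_zero, pow_zero, conjPi_one, pow_zero, padicPi_one, h1, h2]
  | succ n ih =>
    intro k hk hkℓ hun hvn hu hv dun dvn du dv hdun hdvn hdu hdv
    -- Kummer families of `u_{k+n}, v_{k+n}` over `K_ℓ`
    have hkn : C.depth < k + n := by omega
    have hun' : ∀ σ ∈ κ.layerSubgroup ℓ, σ • C.u (k + n) = C.u (k + n) :=
      fun σ hσ ↦ C.smul_u_eq hkn (κ.layerSubgroup_antitone (by omega) hσ)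
    have hvn' : ∀ σ ∈ κ.layerSubgroup ℓ, σ • C.v (k + n) = C.v (k + n) :=
      fun σ hσ ↦ C.smul_v_eq hkn (κ.layerSubgroup_antitone (by omega) hσ)
    obtain ⟨dun', hdun'⟩ := exists_isKummerFamilyOver (W.baseChange K) p (κ.layerSubgroup ℓ) _ hun'
    obtain ⟨dvn', hdvn'⟩ := exists_isKummerFamilyOver (W.baseChange K) p (κ.layerSubgroup ℓ) _ hvn'
    have hℓ : κ.layerSubgroup ℓ ≤ κ.layerSubgroup (k + n) := κ.layerSubgroup_antitone (by omega)
    have hstep := sum_conjPi_kummerDiff_eq_unitRoot_smul C hord hγ hkn hℓ (hvu (k + n) hkn)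
      (hnorm (k + n) hkn) hdun hdvn hdun' hdvn'
    rw [pow_succ p n, (W.baseChange K).sum_range_mul_conjPi_pow p _ γ (p ^ n) p (p ^ k)]
    have hexp : ∀ j, p ^ k * p ^ n * j = p ^ (k + n) * j := fun j ↦ by rw [← pow_add]
    simp_rw [hexp]
    rw [hstep, sum_conjPi_padicPi, ih k hk (by omega) hdun' hdvn' hdu hdv, padicPi_padicPi, pow_succ']

end Iterated

end Literature.NumberTheory.EllipticCurves

end
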